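import Summits.HodgeConjecture.HodgeConjecture.Theorems.Ring2WeilCoverageCMFieldNormWitnesses
import Summits.HodgeConjecture.HodgeConjecture.Theorems.Ring2WeilCoverageCMFieldNonGalois
import Summits.HodgeConjecture.HodgeConjecture.Theorems.Ring2WeilCoverageCMFieldNormDescentInstances
import HarnessLib

/-!
# Weil-type components over quartic CM fields, VII (part C): the census tables `n ≤ 40` as DECISION THEOREMS —
# `[n] = [1] ↔ n ∈ S_E` for `ℚ(√-(2+√2))`, `ℚ(√-(3+√2))`

research route conditional on HC_CM; not a corollary; Q11.4-sentence-2 already refuted in dim ≥ 3. Cell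
`pub-hodge-ring2`, seat `ring2-b03` (gen 49); kernel form of the tables of the Weil-type family-coverage census
`HOME/WEIL-FAMILY-COVERAGE.md` §b03.5 («rational integers `n ≤ 40`: the COMPLETE list with `[n] = [1]`»), one
theorem per field: for `E = ℚ[T]/(R(T²))` over `F = ℚ[S]/(R)` on Deligne's carriers
(`Deligne1982/WeilTypeCMDiscriminant`) and every `1 ≤ n ≤ 40`, the class `[n] ∈ F^×/Nm_{E/F}(E^×)`
(`cmNormResidueGroup R`) EQUALS the split class `[(-1)²]` (`splitDiscriminantClassCM R 2`; the component `W8.E.[n]`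
of the census has an `E`-Lagrangian member, Deligne Cor. 4.2) IF AND ONLY IF `n` lies in the displayed finite set
`S_E`. Each of the 40 cases is ONE `exact`: a split entry by the integer-coordinate norm witness `(A + Bσ)² - σ(C +
Dσ)² = n·m²` of part VI (`mk_eq_splitDiscriminantClassCM_two_of_coords_of_pos` of
`Ring2WeilCoverageCMFieldNormWitnesses`, applied inline with the witness `n A B C D m`; the prime entries are also
available there by name), a non-split entry by the certificate of gens 46–48 that decides it (local obstruction at
an inert / ramified / degree-one place; files `Ring2WeilCoverageCMField{Zeta5, NormDescent, NormDescentInstances,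
Criteria, Biquadratic, InertPrimes, Ramified, SquareClasses, DegreeOnePrimes, DegreeOneCriteria, NonGalois}`). The
sets `S_E` agree with the census tables (PARI `rnfisnorm` + the disjoint stdlib code, ×2 by ring2-b06's third code,
§b03.5 / §b06.1); this file makes the `n ≤ 40` index of every CM-field component table kernel-decided in both
directions. Companion tables: parts A (`ℚ(ζ₅)`, `ℚ(ζ₈)`, `ℚ(ζ₁₂)`) and B (`ℚ(√-3,√5)`, `ℚ(i,√5)`).

No named fact, no definition, no `sorry`; nothing about the Hodge conjecture is asserted (which row is the split one
is decided; the general member of every row, split or not, is OPEN — census §b03.2). References: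
[Deligne1982HodgeCycles] §4 p. 30 (1), Cor. 4.2, Lemma 4.6; [Landherr1936HermitianForms]. -/

noncomputable section

set_option linter.dupNamespace false

open Polynomial

namespace Summit.HodgeConjecture.HodgeConjecture.Ring2.WeilCoverageCM

open Literature.AlgebraicGeometry.Deligne1982
open Literature.AlgebraicGeometry.HodgeTheory (splitDiscriminantClassCM)

/-! ### §1 `E = ℚ(√-(2+√2))`, `R = S² + 4S + 2`: `S_E` has 16 elements, 24 classes `n ≤ 40` are non-split -/

section SqrtNegTwoPlusSqrtTwo

variable {R : Polynomial ℤ} (hR : R = X ^ 2 + C 4 * X + C 2) [Fact (Irreducible (realPolyQ R))]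
include hR

/-- **DECISION TABLE for `E = ℚ(√-(2+√2))` (`R = S² + 4S + 2`), `1 ≤ n ≤ 40`: `[n] = [1]` in `F^×/Nm_{E/F}(E^×)` —
the component `W8.E.[n]` is the SPLIT one — iff `n ∈ {1, 2, 4, 7, 8, 9, 14, 16, 17, 18, 23, 25, 28, 32, 34, 36}`.**
Split entries by integer norm witnesses; non-split entries by the `ℓw` certificates at `ℓ = 3` (`…NormDescent`), `5`
(`…NormDescentInstances`), `11, 13, 19, 29, 31, 37` (`…InertPrimes`) and `[27] = [3]·[3²]` (`…SquareClasses`).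
Agrees with census §b03.5 (three independent computations).
[cite: Deligne1982HodgeCycles, §4 p. 30 (1) and Cor. 4.2] -/
theorem sqrtNegTwoPlusSqrtTwo_table (n : ℕ) (h1 : 1 ≤ n) (h40 : n ≤ 40) (u : (realField R)ˣ)
    (hu : (u : realField R) = n) :
    (QuotientGroup.mk u : cmNormResidueGroup R) = splitDiscriminantClassCM R 2 ↔
      n ∈ ({1, 2, 4, 7, 8, 9, 14, 16, 17, 18, 23, 25, 28, 32, 34, 36} : Finset ℕ) := by
  interval_cases n
  · exact iff_of_true (mk_eq_splitDiscriminantClassCM_two_of_coords_of_pos hR (by norm_num) (by norm_num)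
      disc_not_sq_four_two 1 1 0 0 0 1 one_ne_zero (by norm_num) (by norm_num) u (by rw [hu]; norm_num)) (by decide)
  · exact iff_of_true (mk_eq_splitDiscriminantClassCM_two_of_coords_of_pos hR (by norm_num) (by norm_num)
      disc_not_sq_four_two 2 2 1 0 0 1 one_ne_zero (by norm_num) (by norm_num) u (by rw [hu]; norm_num)) (by decide)
  · exact iff_of_false (sqrtNegTwoPlusSqrtTwo_mk_three_mul_ne_splitDiscriminantClassCM hR 1 (by norm_num) u
      (by rw [hu]; norm_num)) (by decide)
  · exact iff_of_true (mk_eq_splitDiscriminantClassCM_two_of_coords_of_pos hR (by norm_num) (by norm_num)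
      disc_not_sq_four_two 4 2 0 0 0 1 one_ne_zero (by norm_num) (by norm_num) u (by rw [hu]; norm_num)) (by decide)
  · exact iff_of_false (sqrtNegTwoPlusSqrtTwo_mk_five_mul_ne_splitDiscriminantClassCM hR 1 (by norm_num) u
      (by rw [hu]; norm_num)) (by decide)
  · exact iff_of_false (sqrtNegTwoPlusSqrtTwo_mk_three_mul_ne_splitDiscriminantClassCM hR 2 (by norm_num) u
      (by rw [hu]; norm_num)) (by decide)
  · exact iff_of_true (mk_eq_splitDiscriminantClassCM_two_of_coords_of_pos hR (by norm_num) (by norm_num)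
      disc_not_sq_four_two 7 3 1 2 1 1 one_ne_zero (by norm_num) (by norm_num) u (by rw [hu]; norm_num)) (by decide)
  · exact iff_of_true (mk_eq_splitDiscriminantClassCM_two_of_coords_of_pos hR (by norm_num) (by norm_num)
      disc_not_sq_four_two 8 4 2 0 0 1 one_ne_zero (by norm_num) (by norm_num) u (by rw [hu]; norm_num)) (by decide)
  · exact iff_of_true (mk_eq_splitDiscriminantClassCM_two_of_coords_of_pos hR (by norm_num) (by norm_num)
      disc_not_sq_four_two 9 3 0 0 0 1 one_ne_zero (by norm_num) (by norm_num) u (by rw [hu]; norm_num)) (by decide)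
  · exact iff_of_false (sqrtNegTwoPlusSqrtTwo_mk_five_mul_ne_splitDiscriminantClassCM hR 2 (by norm_num) u
      (by rw [hu]; norm_num)) (by decide)
  · exact iff_of_false (sqrtNegTwoPlusSqrtTwo_mk_eleven_mul_ne_splitDiscriminantClassCM hR 1 (by norm_num) u
      (by rw [hu]; norm_num)) (by decide)
  · exact iff_of_false (sqrtNegTwoPlusSqrtTwo_mk_three_mul_ne_splitDiscriminantClassCM hR 4 (by norm_num) u
      (by rw [hu]; norm_num)) (by decide)
  · exact iff_of_false (sqrtNegTwoPlusSqrtTwo_mk_thirteen_mul_ne_splitDiscriminantClassCM hR 1 (by norm_num) u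
      (by rw [hu]; norm_num)) (by decide)
  · exact iff_of_true (mk_eq_splitDiscriminantClassCM_two_of_coords_of_pos hR (by norm_num) (by norm_num)
      disc_not_sq_four_two 14 4 1 2 0 1 one_ne_zero (by norm_num) (by norm_num) u (by rw [hu]; norm_num)) (by decide)
  · exact iff_of_false (sqrtNegTwoPlusSqrtTwo_mk_three_mul_ne_splitDiscriminantClassCM hR 5 (by norm_num) u
      (by rw [hu]; norm_num)) (by decide)
  · exact iff_of_true (mk_eq_splitDiscriminantClassCM_two_of_coords_of_pos hR (by norm_num) (by norm_num)
      disc_not_sq_four_two 16 4 0 0 0 1 one_ne_zero (by norm_num) (by norm_num) u (by rw [hu]; norm_num)) (by decide)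
  · exact iff_of_true (mk_eq_splitDiscriminantClassCM_two_of_coords_of_pos hR (by norm_num) (by norm_num)
      disc_not_sq_four_two 17 5 2 2 0 1 one_ne_zero (by norm_num) (by norm_num) u (by rw [hu]; norm_num)) (by decide)
  · exact iff_of_true (mk_eq_splitDiscriminantClassCM_two_of_coords_of_pos hR (by norm_num) (by norm_num)
      disc_not_sq_four_two 18 6 3 0 0 1 one_ne_zero (by norm_num) (by norm_num) u (by rw [hu]; norm_num)) (by decide)
  · exact iff_of_false (sqrtNegTwoPlusSqrtTwo_mk_nineteen_mul_ne_splitDiscriminantClassCM hR 1 (by norm_num) u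
      (by rw [hu]; norm_num)) (by decide)
  · exact iff_of_false (sqrtNegTwoPlusSqrtTwo_mk_five_mul_ne_splitDiscriminantClassCM hR 4 (by norm_num) u
      (by rw [hu]; norm_num)) (by decide)
  · exact iff_of_false (sqrtNegTwoPlusSqrtTwo_mk_three_mul_ne_splitDiscriminantClassCM hR 7 (by norm_num) u
      (by rw [hu]; norm_num)) (by decide)
  · exact iff_of_false (sqrtNegTwoPlusSqrtTwo_mk_eleven_mul_ne_splitDiscriminantClassCM hR 2 (by norm_num) u
      (by rw [hu]; norm_num)) (by decide)
  · exact iff_of_true (mk_eq_splitDiscriminantClassCM_two_of_coords_of_pos hR (by norm_num) (by norm_num)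
      disc_not_sq_four_two 23 3 1 6 1 1 one_ne_zero (by norm_num) (by norm_num) u (by rw [hu]; norm_num)) (by decide)
  · exact iff_of_false (sqrtNegTwoPlusSqrtTwo_mk_three_mul_ne_splitDiscriminantClassCM hR 8 (by norm_num) u
      (by rw [hu]; norm_num)) (by decide)
  · exact iff_of_true (mk_eq_splitDiscriminantClassCM_two_of_coords_of_pos hR (by norm_num) (by norm_num)
      disc_not_sq_four_two 25 5 0 0 0 1 one_ne_zero (by norm_num) (by norm_num) u (by rw [hu]; norm_num)) (by decide)
  · exact iff_of_false (sqrtNegTwoPlusSqrtTwo_mk_thirteen_mul_ne_splitDiscriminantClassCM hR 2 (by norm_num) u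
      (by rw [hu]; norm_num)) (by decide)
  · exact iff_of_false (sqrtNegTwoPlusSqrtTwo_mk_twentySeven_mul_ne_splitDiscriminantClassCM hR 1 (by norm_num) u
      (by rw [hu]; norm_num)) (by decide)
  · exact iff_of_true (mk_eq_splitDiscriminantClassCM_two_of_coords_of_pos hR (by norm_num) (by norm_num)
      disc_not_sq_four_two 28 6 2 4 2 1 one_ne_zero (by norm_num) (by norm_num) u (by rw [hu]; norm_num)) (by decide)
  · exact iff_of_false (sqrtNegTwoPlusSqrtTwo_mk_twentyNine_mul_ne_splitDiscriminantClassCM hR 1 (by norm_num) u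
      (by rw [hu]; norm_num)) (by decide)
  · exact iff_of_false (sqrtNegTwoPlusSqrtTwo_mk_three_mul_ne_splitDiscriminantClassCM hR 10 (by norm_num) u
      (by rw [hu]; norm_num)) (by decide)
  · exact iff_of_false (sqrtNegTwoPlusSqrtTwo_mk_thirtyOne_mul_ne_splitDiscriminantClassCM hR 1 (by norm_num) u
      (by rw [hu]; norm_num)) (by decide)
  · exact iff_of_true (mk_eq_splitDiscriminantClassCM_two_of_coords_of_pos hR (by norm_num) (by norm_num)
      disc_not_sq_four_two 32 8 4 0 0 1 one_ne_zero (by norm_num) (by norm_num) u (by rw [hu]; norm_num)) (by decide)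
  · exact iff_of_false (sqrtNegTwoPlusSqrtTwo_mk_three_mul_ne_splitDiscriminantClassCM hR 11 (by norm_num) u
      (by rw [hu]; norm_num)) (by decide)
  · exact iff_of_true (mk_eq_splitDiscriminantClassCM_two_of_coords_of_pos hR (by norm_num) (by norm_num)
      disc_not_sq_four_two 34 6 1 4 2 1 one_ne_zero (by norm_num) (by norm_num) u (by rw [hu]; norm_num)) (by decide)
  · exact iff_of_false (sqrtNegTwoPlusSqrtTwo_mk_five_mul_ne_splitDiscriminantClassCM hR 7 (by norm_num) u
      (by rw [hu]; norm_num)) (by decide)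
  · exact iff_of_true (mk_eq_splitDiscriminantClassCM_two_of_coords_of_pos hR (by norm_num) (by norm_num)
      disc_not_sq_four_two 36 6 0 0 0 1 one_ne_zero (by norm_num) (by norm_num) u (by rw [hu]; norm_num)) (by decide)
  · exact iff_of_false (sqrtNegTwoPlusSqrtTwo_mk_thirtySeven_mul_ne_splitDiscriminantClassCM hR 1 (by norm_num) u
      (by rw [hu]; norm_num)) (by decide)
  · exact iff_of_false (sqrtNegTwoPlusSqrtTwo_mk_nineteen_mul_ne_splitDiscriminantClassCM hR 2 (by norm_num) u
      (by rw [hu]; norm_num)) (by decide)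
  · exact iff_of_false (sqrtNegTwoPlusSqrtTwo_mk_three_mul_ne_splitDiscriminantClassCM hR 13 (by norm_num) u
      (by rw [hu]; norm_num)) (by decide)
  · exact iff_of_false (sqrtNegTwoPlusSqrtTwo_mk_five_mul_ne_splitDiscriminantClassCM hR 8 (by norm_num) u
      (by rw [hu]; norm_num)) (by decide)

end SqrtNegTwoPlusSqrtTwo

/-! ### §2 `E = ℚ(√-(3+√2))`, `R = S² + 6S + 7`: `S_E` has 13 elements, 27 classes `n ≤ 40` are non-split -/

section SqrtNegThreePlusSqrtTwo

variable {R : Polynomial ℤ} (hR : R = X ^ 2 + C 6 * X + C 7) [Fact (Irreducible (realPolyQ R))]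
include hR

/-- **DECISION TABLE for `E = ℚ(√-(3+√2))` (`R = S² + 6S + 7`), `1 ≤ n ≤ 40`: `[n] = [1]` in `F^×/Nm_{E/F}(E^×)` —
the component `W8.E.[n]` is the SPLIT one — iff `n ∈ {1, 2, 4, 8, 9, 16, 18, 21, 25, 29, 32, 36, 37}`.** Split
entries by integer norm witnesses; non-split entries by the residues mod the ramified degree-one place `(3+√2)` over
`7` (`…NonGalois`: `n ≡ 3,5,6 (7)`, `[7w]` with `w ≡ 1,2,4`), the half-split prime `23` (`…NonGalois`) and the inert
primes `5, 11, 13` (`…InertPrimes`). Agrees with census §b03.5 (three independent computations).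
[cite: Deligne1982HodgeCycles, §4 p. 30 (1) and Cor. 4.2] -/
theorem sqrtNegThreePlusSqrtTwo_table (n : ℕ) (h1 : 1 ≤ n) (h40 : n ≤ 40) (u : (realField R)ˣ)
    (hu : (u : realField R) = n) :
    (QuotientGroup.mk u : cmNormResidueGroup R) = splitDiscriminantClassCM R 2 ↔
      n ∈ ({1, 2, 4, 8, 9, 16, 18, 21, 25, 29, 32, 36, 37} : Finset ℕ) := by
  interval_cases n
  · exact iff_of_true (mk_eq_splitDiscriminantClassCM_two_of_coords_of_pos hR (by norm_num) (by norm_num)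
      disc_not_sq_six_seven 1 1 0 0 0 1 one_ne_zero (by norm_num) (by norm_num) u (by rw [hu]; norm_num)) (by decide)
  · exact iff_of_true (mk_eq_splitDiscriminantClassCM_two_of_coords_of_pos hR (by norm_num) (by norm_num)
      disc_not_sq_six_seven 2 3 1 0 0 1 one_ne_zero (by norm_num) (by norm_num) u (by rw [hu]; norm_num)) (by decide)
  · exact iff_of_false (sqrtNegThreePlusSqrtTwo_mk_ne_splitDiscriminantClassCM_of_residue hR 3 (by decide) u
      (by rw [hu]; norm_num)) (by decide)
  · exact iff_of_true (mk_eq_splitDiscriminantClassCM_two_of_coords_of_pos hR (by norm_num) (by norm_num)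
      disc_not_sq_six_seven 4 2 0 0 0 1 one_ne_zero (by norm_num) (by norm_num) u (by rw [hu]; norm_num)) (by decide)
  · exact iff_of_false (sqrtNegThreePlusSqrtTwo_mk_ne_splitDiscriminantClassCM_of_residue hR 5 (by decide) u
      (by rw [hu]; norm_num)) (by decide)
  · exact iff_of_false (sqrtNegThreePlusSqrtTwo_mk_ne_splitDiscriminantClassCM_of_residue hR 6 (by decide) u
      (by rw [hu]; norm_num)) (by decide)
  · exact iff_of_false (sqrtNegThreePlusSqrtTwo_mk_seven_mul_ne_splitDiscriminantClassCM hR 1 (by decide) u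
      (by rw [hu]; norm_num)) (by decide)
  · exact iff_of_true (mk_eq_splitDiscriminantClassCM_two_of_coords_of_pos hR (by norm_num) (by norm_num)
      disc_not_sq_six_seven 8 6 2 0 0 1 one_ne_zero (by norm_num) (by norm_num) u (by rw [hu]; norm_num)) (by decide)
  · exact iff_of_true (mk_eq_splitDiscriminantClassCM_two_of_coords_of_pos hR (by norm_num) (by norm_num)
      disc_not_sq_six_seven 9 3 0 0 0 1 one_ne_zero (by norm_num) (by norm_num) u (by rw [hu]; norm_num)) (by decide)
  · exact iff_of_false (sqrtNegThreePlusSqrtTwo_mk_ne_splitDiscriminantClassCM_of_residue hR 10 (by decide) u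
      (by rw [hu]; norm_num)) (by decide)
  · exact iff_of_false (sqrtNegThreePlusSqrtTwo_mk_eleven_mul_ne_splitDiscriminantClassCM hR 1 (by norm_num) u
      (by rw [hu]; norm_num)) (by decide)
  · exact iff_of_false (sqrtNegThreePlusSqrtTwo_mk_ne_splitDiscriminantClassCM_of_residue hR 12 (by decide) u
      (by rw [hu]; norm_num)) (by decide)
  · exact iff_of_false (sqrtNegThreePlusSqrtTwo_mk_ne_splitDiscriminantClassCM_of_residue hR 13 (by decide) u
      (by rw [hu]; norm_num)) (by decide)
  · exact iff_of_false (sqrtNegThreePlusSqrtTwo_mk_seven_mul_ne_splitDiscriminantClassCM hR 2 (by decide) u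
      (by rw [hu]; norm_num)) (by decide)
  · exact iff_of_false (sqrtNegThreePlusSqrtTwo_mk_five_mul_ne_splitDiscriminantClassCM hR 3 (by norm_num) u
      (by rw [hu]; norm_num)) (by decide)
  · exact iff_of_true (mk_eq_splitDiscriminantClassCM_two_of_coords_of_pos hR (by norm_num) (by norm_num)
      disc_not_sq_six_seven 16 4 0 0 0 1 one_ne_zero (by norm_num) (by norm_num) u (by rw [hu]; norm_num)) (by decide)
  · exact iff_of_false (sqrtNegThreePlusSqrtTwo_mk_ne_splitDiscriminantClassCM_of_residue hR 17 (by decide) u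
      (by rw [hu]; norm_num)) (by decide)
  · exact iff_of_true (mk_eq_splitDiscriminantClassCM_two_of_coords_of_pos hR (by norm_num) (by norm_num)
      disc_not_sq_six_seven 18 5 1 2 0 1 one_ne_zero (by norm_num) (by norm_num) u (by rw [hu]; norm_num)) (by decide)
  · exact iff_of_false (sqrtNegThreePlusSqrtTwo_mk_ne_splitDiscriminantClassCM_of_residue hR 19 (by decide) u
      (by rw [hu]; norm_num)) (by decide)
  · exact iff_of_false (sqrtNegThreePlusSqrtTwo_mk_ne_splitDiscriminantClassCM_of_residue hR 20 (by decide) u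
      (by rw [hu]; norm_num)) (by decide)
  · exact iff_of_true (mk_eq_splitDiscriminantClassCM_two_of_coords_of_pos hR (by norm_num) (by norm_num)
      disc_not_sq_six_seven 21 0 1 5 1 1 one_ne_zero (by norm_num) (by norm_num) u (by rw [hu]; norm_num)) (by decide)
  · exact iff_of_false (sqrtNegThreePlusSqrtTwo_mk_eleven_mul_ne_splitDiscriminantClassCM hR 2 (by norm_num) u
      (by rw [hu]; norm_num)) (by decide)
  · exact iff_of_false (sqrtNegThreePlusSqrtTwo_mk_twentyThree_mul_ne_splitDiscriminantClassCM hR 1 (by norm_num) u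
      (by rw [hu]; norm_num)) (by decide)
  · exact iff_of_false (sqrtNegThreePlusSqrtTwo_mk_ne_splitDiscriminantClassCM_of_residue hR 24 (by decide) u
      (by rw [hu]; norm_num)) (by decide)
  · exact iff_of_true (mk_eq_splitDiscriminantClassCM_two_of_coords_of_pos hR (by norm_num) (by norm_num)
      disc_not_sq_six_seven 25 5 0 0 0 1 one_ne_zero (by norm_num) (by norm_num) u (by rw [hu]; norm_num)) (by decide)
  · exact iff_of_false (sqrtNegThreePlusSqrtTwo_mk_ne_splitDiscriminantClassCM_of_residue hR 26 (by decide) u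
      (by rw [hu]; norm_num)) (by decide)
  · exact iff_of_false (sqrtNegThreePlusSqrtTwo_mk_ne_splitDiscriminantClassCM_of_residue hR 27 (by decide) u
      (by rw [hu]; norm_num)) (by decide)
  · exact iff_of_false (sqrtNegThreePlusSqrtTwo_mk_seven_mul_ne_splitDiscriminantClassCM hR 4 (by decide) u
      (by rw [hu]; norm_num)) (by decide)
  · exact iff_of_true (mk_eq_splitDiscriminantClassCM_two_of_coords_of_pos hR (by norm_num) (by norm_num)
      disc_not_sq_six_seven 29 8 3 5 1 1 one_ne_zero (by norm_num) (by norm_num) u (by rw [hu]; norm_num)) (by decide)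
  · exact iff_of_false (sqrtNegThreePlusSqrtTwo_mk_five_mul_ne_splitDiscriminantClassCM hR 6 (by norm_num) u
      (by rw [hu]; norm_num)) (by decide)
  · exact iff_of_false (sqrtNegThreePlusSqrtTwo_mk_ne_splitDiscriminantClassCM_of_residue hR 31 (by decide) u
      (by rw [hu]; norm_num)) (by decide)
  · exact iff_of_true (mk_eq_splitDiscriminantClassCM_two_of_coords_of_pos hR (by norm_num) (by norm_num)
      disc_not_sq_six_seven 32 12 4 0 0 1 one_ne_zero (by norm_num) (by norm_num) u (by rw [hu]; norm_num))
      (by decide)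
  · exact iff_of_false (sqrtNegThreePlusSqrtTwo_mk_ne_splitDiscriminantClassCM_of_residue hR 33 (by decide) u
      (by rw [hu]; norm_num)) (by decide)
  · exact iff_of_false (sqrtNegThreePlusSqrtTwo_mk_ne_splitDiscriminantClassCM_of_residue hR 34 (by decide) u
      (by rw [hu]; norm_num)) (by decide)
  · exact iff_of_false (sqrtNegThreePlusSqrtTwo_mk_five_mul_ne_splitDiscriminantClassCM hR 7 (by norm_num) u
      (by rw [hu]; norm_num)) (by decide)
  · exact iff_of_true (mk_eq_splitDiscriminantClassCM_two_of_coords_of_pos hR (by norm_num) (by norm_num)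
      disc_not_sq_six_seven 36 6 0 0 0 1 one_ne_zero (by norm_num) (by norm_num) u (by rw [hu]; norm_num)) (by decide)
  · exact iff_of_true (mk_eq_splitDiscriminantClassCM_two_of_coords_of_pos hR (by norm_num) (by norm_num)
      disc_not_sq_six_seven 37 3 2 8 2 1 one_ne_zero (by norm_num) (by norm_num) u (by rw [hu]; norm_num)) (by decide)
  · exact iff_of_false (sqrtNegThreePlusSqrtTwo_mk_ne_splitDiscriminantClassCM_of_residue hR 38 (by decide) u
      (by rw [hu]; norm_num)) (by decide)
  · exact iff_of_false (sqrtNegThreePlusSqrtTwo_mk_thirteen_mul_ne_splitDiscriminantClassCM hR 3 (by norm_num) u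
      (by rw [hu]; norm_num)) (by decide)
  · exact iff_of_false (sqrtNegThreePlusSqrtTwo_mk_ne_splitDiscriminantClassCM_of_residue hR 40 (by decide) u
      (by rw [hu]; norm_num)) (by decide)

end SqrtNegThreePlusSqrtTwo

end Summit.HodgeConjecture.HodgeConjecture.Ring2.WeilCoverageCM

end
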